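import Summits.RiemannHypothesis.RiemannHypothesis.Theorems.SemilocalDeletionCliffMulti
import Summits.RiemannHypothesis.RiemannHypothesis.Theorems.HandoffSemilocalEnergy
import HarnessLib

/-!
# The deletion cliff FLOOR as an RH-falsifier: a deleted semi-local form below `−Σ_{p∈D} Λ(p)/√p` refutes RH

`SemilocalDeletionCliff(Multi).lean` proved, with no hypothesis at all, that deleting a set `D` of primes (each a single visible atom,
`c < log p`) from `S` lowers the semi-local Weil form by at most `(Σ_{p∈D} log p/√p)·‖g‖₂²` on the window `C(c)`.  Weil's criterion in
Yoshida's form (tree: `riemannHypothesis_iff_forall_weilPositivityOn`; Bombieri 2000 Thm 2) makes the UNDELETED form positive under RH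
whenever `S` contains every prime visible on the window.  Hence the floor side of the cliff law is a family of FALSIFIABLE predictions of
RH about finite-`S` forms — objects the cell computes with certified finite sections (lineage E; idea-1 PART O):

* §1 RH ⇒ `WeilSemilocalPositivityOn S c` for every finite `S ⊇ {primes ≤ N}`, `c ≤ (log (N+1))/2`;
* §2 the energy form of the multi-prime sum floor: `λ_min(S∖D; c; P) ≥ λ_min(S; c; P) − Σ_{p∈D} log p/√p` (every constraint `P`);
* §3 **falsifiers**: a test function `g ∈ C(c)` with `Re Q_{S∖D}(g) < −(Σ_{p∈D} log p/√p)‖g‖₂²`, or a constrained bottom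
  `λ_min(S∖D; c; P) < −Σ_{p∈D} log p/√p`, or — at a wall of consecutive primes `q < q'`, window `b ∈ (0, (log q')/2]`, `b < log q` —
  an old-form bottom `λ_min(S_q; b; P) < −log q/√q`, REFUTES RH.  (All certified cells of the cell sit above their floors: e.g.
  `λ_min(S_7; 1.7; odd) = −0.735484904011 ≥ −log 7/√7 = −0.735484904016…`, WALSH-E §4; idea-1 PART O 16/16.)

The ceiling side (deficit ≤ cap and ≥ cap − 2ε, loads in a band) is `SemilocalDeletionCliffRH.lean`.  Consequences of RH, not evidence for it.
-/

set_option linter.dupNamespace false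

noncomputable section

open Complex Filter Set MeasureTheory
open scoped Real Topology ComplexConjugate

namespace Summit.RiemannHypothesis.RiemannHypothesis.Theorems.SemilocalDeletionCliffFalsifiers

open Literature.NumberTheory.LFunctions
open Summit.RiemannHypothesis.RiemannHypothesis.Theorems.SemilocalDeletionCliff
open Summit.RiemannHypothesis.RiemannHypothesis.Theorems.HandoffSemilocalEnergy
open Summit.RiemannHypothesis.RiemannHypothesis.Theorems.Handoff

variable {g : ℝ → ℂ} {S D : Finset ℕ} {N : ℕ} {c : ℝ} {P : (ℝ → ℂ) → Prop}

/-! ## §1  RH supplies positivity of every visible-complete semi-local form -/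

/-- RH ⇒ `Q_S ≥ 0` on `C(c)` whenever `S` contains the prime factors of every prime power `n ≤ N` and `0 < c ≤ (log (N+1))/2`
(on that window the `S`-form IS Weil's form; RH ⇒ every rung by `riemannHypothesis_iff_forall_weilPositivityOn`,
cf. `MotivicDoor.Rungs.rung_of_riemannHypothesis`). -/
theorem weilSemilocalPositivityOn_of_riemannHypothesis (hRH : Summit.RiemannHypothesis)
    (hS : ∀ n ≤ N, IsPrimePow n → n.primeFactors ⊆ S) (hc : 0 < c) (hcN : c ≤ Real.log ((N : ℝ) + 1) / 2) :
    WeilSemilocalPositivityOn S c :=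
  (MotivicDoor.Semilocal.weilSemilocalPositivityOn_iff_weilPositivityOn_of_le hS hcN).2
    ((riemannHypothesis_iff_forall_weilPositivityOn.1 (Summit.RiemannHypothesis_iff.1 hRH)) c hc)

/-! ## §2  Energy form of the multi-prime sum floor -/

/-- **Sum floor for the bottoms.** For primes `D ⊆ S` with `c < log p` (`p ∈ D`):
`λ_min(S∖D; c; P) ≥ λ_min(S; c; P) − Σ_{p∈D} log p/√p` for every constraint `P`
(`SemilocalDeletionCliff.re_weilSemilocalQuadratic_sdiff_ge` on the unit sphere). -/
theorem semilocalGroundEnergy_sdiff_ge_sum (hDS : D ⊆ S) (hprime : ∀ p ∈ D, p.Prime) (hlog : ∀ p ∈ D, c < Real.log p) :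
    semilocalGroundEnergy S P c - ∑ p ∈ D, Real.log p / Real.sqrt p ≤ semilocalGroundEnergy (S \ D) P c := by
  have hw : 0 ≤ ∑ p ∈ D, Real.log p / Real.sqrt p := Finset.sum_nonneg fun p hp ↦
    div_nonneg (Real.log_nonneg (by exact_mod_cast (hprime p hp).one_lt.le)) (Real.sqrt_nonneg _)
  rcases (semilocalSphereValues (S \ D) P c).eq_empty_or_nonempty with he | hne
  · have he' : semilocalSphereValues S P c = ∅ := by
      rcases (semilocalSphereValues S P c).eq_empty_or_nonempty with h0 | h0
      · exact h0
      · have := (semilocalSphereValues_nonempty_iff S P c).1 h0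
        rw [← semilocalSphereValues_nonempty_iff (S \ D) P c, he] at this
        exact absurd this Set.not_nonempty_empty
    rw [semilocalGroundEnergy, semilocalGroundEnergy, he, he', Real.sInf_empty]
    linarith
  · refine le_semilocalGroundEnergy hne fun g hg hs hPg hn ↦ ?_
    have h1 := re_weilSemilocalQuadratic_sdiff_ge hg hs D hDS hprime hlog
    have h2 := semilocalGroundEnergy_le_re (S := S) hg hs hPg hn
    rw [hn, mul_one] at h1
    linarith

/-! ## §3  Falsifiers -/

/-- **FALSIFIER (one test function).** `S ⊇ {prime factors of prime powers ≤ N}`, `0 < c ≤ (log (N+1))/2`, `D ⊆ S` primes with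
`c < log p`: a Weil test function `g ∈ C(c)` with `Re Q_{S∖D}(g) < −(Σ_{p∈D} log p/√p)·‖g‖₂²` refutes RH. -/
theorem not_riemannHypothesis_of_re_weilSemilocalQuadratic_sdiff_lt (hS : ∀ n ≤ N, IsPrimePow n → n.primeFactors ⊆ S)
    (hc : 0 < c) (hcN : c ≤ Real.log ((N : ℝ) + 1) / 2) (hg : IsWeilTest g) (hsupp : tsupport g ⊆ Icc (-c) c)
    (hDS : D ⊆ S) (hprime : ∀ p ∈ D, p.Prime) (hlog : ∀ p ∈ D, c < Real.log p)
    (hlt : (weilSemilocalQuadratic (S \ D) g).re < -((∑ p ∈ D, Real.log p / Real.sqrt p) * ∫ u : ℝ, ‖g u‖ ^ 2)) :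
    ¬ Summit.RiemannHypothesis := by
  intro hRH
  have h := re_weilSemilocalQuadratic_sdiff_ge_of_weilPositivityOn hg hS hcN
    ((riemannHypothesis_iff_forall_weilPositivityOn.1 (Summit.RiemannHypothesis_iff.1 hRH)) c hc) hsupp D hDS hprime hlog
  linarith

/-- **FALSIFIER (a bottom).** With `S`, `c`, `D` as above and a scaling-stable constraint `P`: a constrained bottom of the deleted
form below the sum floor, `λ_min(S∖D; c; P) < −Σ_{p∈D} log p/√p`, refutes RH. -/
theorem not_riemannHypothesis_of_semilocalGroundEnergy_sdiff_lt (hS : ∀ n ≤ N, IsPrimePow n → n.primeFactors ⊆ S)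
    (hc : 0 < c) (hcN : c ≤ Real.log ((N : ℝ) + 1) / 2) (hDS : D ⊆ S) (hprime : ∀ p ∈ D, p.Prime)
    (hlog : ∀ p ∈ D, c < Real.log p) (hP : ∀ (a : ℝ) (g : ℝ → ℂ), 0 < a → P g → P fun t ↦ (a : ℂ) * g t)
    (hlt : semilocalGroundEnergy (S \ D) P c < -∑ p ∈ D, Real.log p / Real.sqrt p) : ¬ Summit.RiemannHypothesis := by
  intro hRH
  have hpos := weilSemilocalPositivityOn_of_riemannHypothesis hRH hS hc hcN
  have h0 : 0 ≤ semilocalGroundEnergy S P c := (semilocalGroundEnergy_nonneg_iff hP).2 fun g hg hs _ ↦ hpos g hg hs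
  have h1 := semilocalGroundEnergy_sdiff_ge_sum (P := P) hDS hprime hlog
  linarith

variable {q q' : ℕ} {b : ℝ}

/-- For consecutive primes `q < q'`: `S_{q'} ∖ {q} = S_q` (set-difference form). -/
theorem primesBelow_sdiff_singleton (h : ConsecutivePrimes q q') : Nat.primesBelow q' \ {q} = Nat.primesBelow q := by
  ext p
  rw [Finset.mem_sdiff, Finset.mem_singleton, h.primesBelow_eq, Nat.mem_primesBelow, Nat.mem_primesBelow]
  constructor
  · rintro ⟨⟨hlt, hp⟩, hne⟩
    exact ⟨by omega, hp⟩
  · rintro ⟨hlt, hp⟩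
    exact ⟨⟨by omega, hp⟩, by omega⟩

/-- **FALSIFIER AT A WALL.** Consecutive primes `q < q'`, a window `0 < b ≤ (log q')/2` past the old form's single-visibility bound
`b < log q` (automatic for `b ≤ (log q')/2` by Bertrand, but kept explicit), a scaling-stable constraint `P`: an old-form bottom below the
dipole floor, `λ_min(S_q; b; P) < −log q/√q`, refutes RH.  (Every certified cell of the cell's tables respects this floor; the
all-sector version with `P = ⊤` reads `aggregateDeficit q b > log q/√q ⇒ ¬RH`.) -/
theorem not_riemannHypothesis_of_semilocalGroundEnergy_primesBelow_lt (h : ConsecutivePrimes q q') (hb : 0 < b)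
    (hbq' : b ≤ Real.log q' / 2) (hbq : b < Real.log q)
    (hP : ∀ (a : ℝ) (g : ℝ → ℂ), 0 < a → P g → P fun t ↦ (a : ℂ) * g t)
    (hlt : semilocalGroundEnergy (Nat.primesBelow q) P b < -(Real.log q / Real.sqrt q)) : ¬ Summit.RiemannHypothesis := by
  have hS := primeFactors_subset_primesBelow_succ_of_gap h.gap
  rw [← h.primesBelow_eq] at hS
  have hb' : b ≤ Real.log (((q' - 1 : ℕ) : ℝ) + 1) / 2 := by rwa [h.cast_pred_add_one]
  have hq : q ∈ Nat.primesBelow q' := Nat.mem_primesBelow.2 ⟨h.2.2.1, h.1⟩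
  refine not_riemannHypothesis_of_semilocalGroundEnergy_sdiff_lt (D := {q}) hS hb hb' (Finset.singleton_subset_iff.2 hq)
    (fun p hp ↦ by rw [Finset.mem_singleton.1 hp]; exact h.1) (fun p hp ↦ by rw [Finset.mem_singleton.1 hp]; exact hbq) hP ?_
  rwa [primesBelow_sdiff_singleton h, Finset.sum_singleton]

/-- **FALSIFIER AT A WALL, deficit language**: `D_q(b) > cap(q) = log q/√q` for some `0 < b ≤ (log q')/2`, `b < log q`, refutes RH. -/
theorem not_riemannHypothesis_of_cap_lt_aggregateDeficit (h : ConsecutivePrimes q q') (hb : 0 < b) (hbq' : b ≤ Real.log q' / 2)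
    (hbq : b < Real.log q) (hgt : Real.log q / Real.sqrt q < aggregateDeficit q b) : ¬ Summit.RiemannHypothesis := by
  refine not_riemannHypothesis_of_semilocalGroundEnergy_primesBelow_lt (P := fun _ ↦ True) h hb hbq' hbq
    (fun _ _ _ _ ↦ trivial) ?_
  unfold aggregateDeficit at hgt
  linarith

end Summit.RiemannHypothesis.RiemannHypothesis.Theorems.SemilocalDeletionCliffFalsifiers

end
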